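import Literature.NumberTheory.GaloisRepresentations.UnramifiedKummer
import Literature.NumberTheory.GaloisRepresentations.AbsGaloisOuterConj
import Literature.NumberTheory.GaloisRepresentations.BlochKatoSelmerGroup
import Literature.NumberTheory.GaloisRepresentations.ContinuousH1
import HarnessLib

/-!
# Unramified classes are the classes principal on the inertia group:
# `range (Γ_{F^{nr}} → Γ_F) = I_F` and `[φ] ∈ H¹_ur(F, W) ⟺ φ|_{I_F}` is principal

Topic `NumberTheory/GaloisRepresentations` (sequel to `UnramifiedKummer` (`maxUnramified`,
`mem_absInertia_iff_forall_mem_maxUnramified`), `InertiaRootsOfUnity` (`mem_absInertia_iff_smul_rootsOfUnity`),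
`AbsGaloisOuterConj` (`absEmbedding`, `mem_range_absGaloisRestrict_iff_smul_absEmbedding`) and `BlochKatoSelmerGroup`
(`DiscreteGaloisModule.unramifiedSubgroup`)).  Theorems only; no definition, no named fact, no instance, no `sorry`.

The tree's unramified local condition is `H¹_ur(F, W) = ker (H¹(F, W) → H¹(F^{nr}, W))`, restriction along
`absGaloisRestrict F F^{nr} : Γ_{F^{nr}} → Γ_F`, `F^{nr} = maxUnramified F = F(μ_{p'})`.  To work with it on cocycles
one needs the image of that map:

* `§1` `map_one_oneCocycleClass_eq_zero_iff_of_bijective` — for a compatible pair `(θ : L → G, f)` with `f`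
  BIJECTIVE on coefficients, `H¹(θ, f)[φ] = 0` iff `φ` is principal ON THE RANGE of `θ`
  (`∃ x, ∀ l, φ (θ l) = θ l • x − x`); Serre, *Galois Cohomology*, I §2.4, §5.1.
* `§2` **`range (absGaloisRestrict F F^{nr}) = absInertia F`** — `⊇`: `I_F` fixes `F^{nr}` pointwise and the chosen copy
  `e(F^{nr}) ⊆ F̄` lies in `F^{nr}` (`absEmbedding_mem_maxUnramified`); `⊆`: `e(F^{nr})` contains every root of unity of
  order prime to `p` (`exists_absEmbedding_eq_of_pow_eq_one`) and `I_F` is their fixator. Serre, *Local Fields*, IV §4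
  Cor. 2 to Prop. 16 («`K_nr` is obtained by adjoining to `K` all roots of unity of order prime to `p`»); Serre 1972 §1.2
  (`I = Gal(K_s/K_nr)`).
* `§3` **`oneCocycleClass_mem_unramifiedSubgroup_iff_exists`** — `[φ] ∈ H¹_ur(F, W)` iff `∃ w, ∀ τ ∈ I_F, φ τ = τ w − w`,
  for every discrete Galois module `W` over `F`; `oneCocycleClass_mem_unramifiedSubgroup_iff_forall_eq_zero` — if `I_F`
  acts trivially, iff `φ` vanishes on `I_F` (Milne, *ADT*, I §2: `H¹_ur = H¹(G/I, M^I) = ker (H¹(G, M) → H¹(I, M))`).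

PROVENANCE: these statements were first proved on the Summits side (`Summit.BirchSwinnertonDyer.Rank1Residual.X11b.LocBridge`,
files `LocalTrivialityBridge` / `MaxUnramifiedRestriction`, cell `b2b-bsdres`), which Literature files cannot import; this
is their Literature port (same proofs), for the Literature consumers of `unramifiedSubgroup` (Howard 2004 H.4 transport,
`LocalInvariants.UnramifiedOrthogonal`).  No named fact; BSD is not proved by any of this.

References: [SerreLocalFields1979] J.-P. Serre, *Local Fields* (1979), IV §4 Cor. 2 to Prop. 16; [SerreInventiones1972]
J.-P. Serre, Invent. Math. 15 (1972), §1.2; [SerreGaloisCohomology1997] I §2.4, §5.1; [MilneADT2006] J. S. Milne,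
*Arithmetic Duality Theorems* (2006), I §2.
-/

noncomputable section

open scoped Classical

open CategoryTheory Field ValuativeRel

universe u

namespace Literature.NumberTheory.GaloisRepresentations

/-! ## §1. Principal-on-the-range criterion for the map of a compatible pair -/

section TopRepLevel

variable {G L : Type u} [Group G] [TopologicalSpace G] [IsTopologicalGroup G]
  [Group L] [TopologicalSpace L] [IsTopologicalGroup L]

/-- **`[f ∘ φ ∘ θ] = 0 ↔ φ` is principal on `range θ`.**  For a continuous homomorphism `θ : L → G`, topological
representations `X` of `G` and `Y` of `L`, and a morphism `f : res_θ X ⟶ Y` BIJECTIVE on the underlying modules, the class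
of the pulled-back crossed homomorphism `f ∘ φ ∘ θ` vanishes in `H¹(L, Y)` iff there is `x ∈ X` with
`φ(θ l) = θ l • x − x` for all `l ∈ L`.  ("Inflation along a surjection is injective on `H¹`" is the case `range θ = G`.)
[cite: SerreGaloisCohomology1997, I §2.4 and I §5.1] -/
theorem map_one_oneCocycleClass_eq_zero_iff_of_bijective (X : TopRep.{u} ℤ G) (Y : TopRep.{u} ℤ L) (θ : L →ₜ* G)
    (f : TopRep.res (θ : L →* G) X ⟶ Y) (hf : Function.Bijective f.hom) (φ : contOneCocycles X) :
    ContinuousCohomology.map θ f 1 (oneCocycleClass X φ) = 0 ↔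
      ∃ x : X, ∀ l : L, φ.1 (θ l) = X.ρ (θ l) x - x := by
  rw [map_oneCocycleClass, oneCocycleClass_eq_zero_iff]
  constructor
  · rintro ⟨y, hy⟩
    obtain ⟨x, rfl⟩ := hf.2 y
    refine ⟨x, fun l ↦ hf.1 ?_⟩
    have h := hy l
    rw [contOneCocycles.pullback_apply] at h
    rw [h, map_sub, ← TopRep.hom_comm_apply f l x]
    rfl
  · rintro ⟨x, hx⟩
    refine ⟨f.hom x, fun l ↦ ?_⟩
    rw [contOneCocycles.pullback_apply, hx, map_sub, ← TopRep.hom_comm_apply f l x]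
    rfl

end TopRepLevel

namespace IsNonarchimedeanLocalField

section LocalField

variable (F : Type u) [Field F] [ValuativeRel F] [TopologicalSpace F] [IsNonarchimedeanLocalField F]

/-! ## §2. The chosen copy `e(F^{nr})` of `F^{nr}` inside `F̄` is `F^{nr}`; `range (Γ_{F^{nr}} → Γ_F) = I_F` -/

omit [TopologicalSpace F] [IsNonarchimedeanLocalField F] in
/-- **`e(F^{nr}) ⊆ F^{nr}`**: the chosen `F`-embedding `e : F^{nr} → F̄` (`absEmbedding`, along which
`absGaloisRestrict F F^{nr}` restricts) takes values in `F^{nr} = F(μ_{p'})` — a generator (a root of unity of order `N`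
prime to `p`) goes to a root of unity of the same order, and `F(μ_{p'})` is generated by those.
[cite: SerreLocalFields1979, Ch. IV §4 Cor. 2 to Prop. 16] -/
theorem absEmbedding_mem_maxUnramified (x : maxUnramified F) :
    (absEmbedding F (maxUnramified F) x : AlgebraicClosure F) ∈ maxUnramified F := by
  obtain ⟨y, hy⟩ := x
  induction hy using IntermediateField.adjoin_induction with
  | mem y hy =>
    obtain ⟨N, hN, hyN⟩ := hy
    refine IntermediateField.subset_adjoin F _ ⟨N, hN, ?_⟩
    rw [← map_pow]
    have h1 : (⟨y, IntermediateField.subset_adjoin F _ ⟨N, hN, hyN⟩⟩ : maxUnramified F) ^ N = 1 :=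
      Subtype.ext (by rw [SubmonoidClass.coe_pow]; exact hyN)
    rw [h1, map_one]
  | algebraMap a =>
    have h : (⟨algebraMap F (AlgebraicClosure F) a, IntermediateField.algebraMap_mem _ a⟩ :
        maxUnramified F) = algebraMap F (maxUnramified F) a := rfl
    rw [h, AlgHom.commutes]
    exact IntermediateField.algebraMap_mem _ a
  | add y z hy hz ihy ihz =>
    have h : (⟨y + z, add_mem hy hz⟩ : maxUnramified F) = ⟨y, hy⟩ + ⟨z, hz⟩ := rfl
    rw [h, map_add]
    exact add_mem ihy ihz
  | inv y hy ihy =>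
    have h : (⟨y⁻¹, inv_mem hy⟩ : maxUnramified F) = ⟨y, hy⟩⁻¹ := rfl
    rw [h, map_inv₀]
    exact inv_mem ihy
  | mul y z hy hz ihy ihz =>
    have h : (⟨y * z, mul_mem hy hz⟩ : maxUnramified F) = ⟨y, hy⟩ * ⟨z, hz⟩ := rfl
    rw [h, map_mul]
    exact mul_mem ihy ihz

omit [ValuativeRel F] [TopologicalSpace F] [IsNonarchimedeanLocalField F] in
/-- The `N`-th roots of unity of `F̄` form a finite set (`N ≠ 0`). [folklore] -/
private theorem finite_setOf_pow_eq_one_absClosure {N : ℕ} (hN : N ≠ 0) :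
    Set.Finite {ζ : AlgebraicClosure F | ζ ^ N = 1} := by
  refine (Multiset.finite_toSet (Polynomial.nthRoots N (1 : AlgebraicClosure F))).subset ?_
  intro ζ hζ
  exact (Polynomial.mem_nthRoots (Nat.pos_of_ne_zero hN)).mpr hζ

omit [TopologicalSpace F] [IsNonarchimedeanLocalField F] in
/-- **`e(F^{nr}) ⊇ μ_{p'}(F̄)`**: every root of unity `ζ ∈ F̄` of order prime to `p` is `e x` for some `x ∈ F^{nr}` —
`F^{nr}` contains the finite set `μ_N(F̄)`, and `x ↦ e x` is an injective self-map of it, hence onto.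
[cite: SerreLocalFields1979, Ch. IV §4 Cor. 2 to Prop. 16] -/
theorem exists_absEmbedding_eq_of_pow_eq_one {N : ℕ} (hN : IsUnit ((N : ℕ) : 𝒪[F]))
    {ζ : AlgebraicClosure F} (hζ : ζ ^ N = 1) :
    ∃ x : maxUnramified F, (absEmbedding F (maxUnramified F) x : AlgebraicClosure F) = ζ := by
  have hN0 : N ≠ 0 := by rintro rfl; simp at hN
  set R : Set (AlgebraicClosure F) := {ζ : AlgebraicClosure F | ζ ^ N = 1} with hR
  haveI : Finite R := (finite_setOf_pow_eq_one_absClosure F hN0).to_subtype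
  have hmemM : ∀ ξ : R, (ξ : AlgebraicClosure F) ∈ maxUnramified F := fun ξ ↦
    IntermediateField.subset_adjoin F _ ⟨N, hN, ξ.2⟩
  have hpow : ∀ ξ : R, (absEmbedding F (maxUnramified F) ⟨ξ, hmemM ξ⟩ : AlgebraicClosure F) ^ N = 1 :=
    fun ξ ↦ by
      rw [← map_pow]
      have h1 : (⟨(ξ : AlgebraicClosure F), hmemM ξ⟩ : maxUnramified F) ^ N = 1 :=
        Subtype.ext (by rw [SubmonoidClass.coe_pow]; exact ξ.2)
      rw [h1, map_one]
  let g : R → R := fun ξ ↦ ⟨absEmbedding F (maxUnramified F) ⟨ξ, hmemM ξ⟩, hpow ξ⟩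
  have hg : Function.Injective g := fun ξ ξ' h ↦ by
    have h1 := congrArg (fun r : R ↦ (r : AlgebraicClosure F)) h
    have h2 := (absEmbedding F (maxUnramified F)).injective h1
    exact Subtype.ext (congrArg (fun m : maxUnramified F ↦ (m : AlgebraicClosure F)) h2)
  obtain ⟨ξ, hξ⟩ := (Finite.injective_iff_surjective.mp hg) ⟨ζ, hζ⟩
  exact ⟨⟨ξ, hmemM ξ⟩, congrArg (fun r : R ↦ (r : AlgebraicClosure F)) hξ⟩

/-- **The image of `Γ_{F^{nr}} → Γ_F` is the inertia group `I_F = absInertia F`** (`⊆`: an element of the image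
fixes `e(F^{nr}) ⊇ μ_{p'}(F̄)`, and `I_F` is the fixator of `μ_{p'}`; `⊇`: `I_F` fixes `F^{nr} ⊇ e(F^{nr})` pointwise,
and the image is the fixator of `e(F^{nr})`). [cite: SerreLocalFields1979, Ch. IV §4 Cor. 2 to Prop. 16]
[cite: SerreInventiones1972, §1.2] -/
theorem range_absGaloisRestrict_maxUnramified :
    (absGaloisRestrict F (maxUnramified F)).range = absInertia F := by
  ext g
  rw [mem_range_absGaloisRestrict_iff_smul_absEmbedding]
  constructor
  · intro hg
    refine mem_absInertia_iff_smul_rootsOfUnity.mpr fun N hN ζ hζ ↦ ?_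
    obtain ⟨x, rfl⟩ := exists_absEmbedding_eq_of_pow_eq_one F hN hζ
    exact hg x
  · intro hg x
    exact mem_absInertia_iff_forall_mem_maxUnramified.mp hg _ (absEmbedding_mem_maxUnramified F x)

/-- Set form of `range_absGaloisRestrict_maxUnramified`. [cite: SerreLocalFields1979, Ch. IV §4 Cor. 2 to Prop. 16] -/
theorem setRange_absGaloisRestrict_maxUnramified :
    Set.range (absGaloisRestrict F (maxUnramified F)) = (absInertia F : Set (absoluteGaloisGroup F)) := by
  rw [← range_absGaloisRestrict_maxUnramified F]
  rfl

/-- Every element of the inertia group is the restriction of an element of `Γ_{F^{nr}}`.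
[cite: SerreLocalFields1979, Ch. IV §4 Cor. 2 to Prop. 16] -/
theorem exists_absGaloisRestrict_maxUnramified_eq {τ : absoluteGaloisGroup F} (hτ : τ ∈ absInertia F) :
    ∃ l : absoluteGaloisGroup (maxUnramified F), absGaloisRestrict F (maxUnramified F) l = τ := by
  have h : τ ∈ Set.range (absGaloisRestrict F (maxUnramified F)) := by
    rw [setRange_absGaloisRestrict_maxUnramified F]; exact hτ
  exact h

/-- Every restriction of an element of `Γ_{F^{nr}}` lies in the inertia group.
[cite: SerreLocalFields1979, Ch. IV §4 Cor. 2 to Prop. 16] -/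
theorem absGaloisRestrict_maxUnramified_mem_absInertia' (l : absoluteGaloisGroup (maxUnramified F)) :
    absGaloisRestrict F (maxUnramified F) l ∈ absInertia F := by
  rw [← SetLike.mem_coe, ← setRange_absGaloisRestrict_maxUnramified F]
  exact Set.mem_range_self l

end LocalField

end IsNonarchimedeanLocalField

/-! ## §3. `H¹_ur(F, W)` = classes principal on (resp. vanishing on) the inertia group -/

namespace DiscreteGaloisModule

section Unramified

open IsNonarchimedeanLocalField

variable {F : Type u} [Field F] [ValuativeRel F] [TopologicalSpace F] [IsNonarchimedeanLocalField F]
variable {W : Type u} [AddCommGroup W] [TopologicalSpace W] [DiscreteTopology W]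
  (ρ : DiscreteGaloisModule F W)

/-- **`[φ] ∈ H¹_ur(F, W) ⟺ φ` is principal on the inertia group**: for every discrete Galois module `W` over the
local field `F` and every continuous crossed homomorphism `φ`, `[φ] ∈ unramifiedSubgroup ρ 1 = ker (H¹(F, W) →
H¹(F^{nr}, W))` iff `∃ w, ∀ τ ∈ I_F, φ τ = τ w − w` (the restriction is a pull-back along `Γ_{F^{nr}} → Γ_F`, whose kernel
depends only on its range `I_F`). [cite: MilneADT2006, Ch. I §2 (unramified cohomology)] -/
theorem oneCocycleClass_mem_unramifiedSubgroup_iff_exists (φ : contOneCocycles ρ.toTopRep) :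
    oneCocycleClass ρ.toTopRep φ ∈ ρ.unramifiedSubgroup 1 ↔
      ∃ w : W, ∀ τ ∈ absInertia F, φ.1 τ = ρ τ w - w := by
  refine (ρ.mem_unramifiedSubgroup_iff 1 _).trans ?_
  refine (map_one_oneCocycleClass_eq_zero_iff_of_bijective ρ.toTopRep
    (DiscreteGaloisModule.toTopRep (GaloisRep.restrictField (maxUnramified F) ρ))
    (absGaloisRestrict F (maxUnramified F)) (TopRep.ofHom ⟨ContinuousLinearMap.id ℤ W, fun _ ↦ rfl⟩)
    Function.bijective_id φ).trans ?_
  constructor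
  · rintro ⟨w, hw⟩
    refine ⟨w, fun τ hτ ↦ ?_⟩
    obtain ⟨l, rfl⟩ := exists_absGaloisRestrict_maxUnramified_eq F hτ
    exact hw l
  · rintro ⟨w, hw⟩
    exact ⟨w, fun l ↦ hw _ (absGaloisRestrict_maxUnramified_mem_absInertia' F l)⟩

/-- **If the inertia group acts trivially on `W`, `[φ] ∈ H¹_ur(F, W) ⟺ φ` vanishes on `I_F`.**
(Then `H¹_ur(F, W) = H¹(Γ_F/I_F, W)` inflated.) [cite: MilneADT2006, Ch. I §2 (unramified cohomology)] -/
theorem oneCocycleClass_mem_unramifiedSubgroup_iff_forall_eq_zero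
    (hI : ∀ τ ∈ absInertia F, ∀ w : W, ρ τ w = w) (φ : contOneCocycles ρ.toTopRep) :
    oneCocycleClass ρ.toTopRep φ ∈ ρ.unramifiedSubgroup 1 ↔ ∀ τ ∈ absInertia F, φ.1 τ = 0 := by
  rw [oneCocycleClass_mem_unramifiedSubgroup_iff_exists]
  constructor
  · rintro ⟨w, hw⟩ τ hτ
    rw [hw τ hτ, hI τ hτ, sub_self]
  · intro h
    exact ⟨0, fun τ hτ ↦ by rw [h τ hτ, map_zero, sub_zero]⟩

/-- **Membership in `H¹_ur` depends only on the values on the inertia group**: a class is unramified iff SOME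
(equivalently every) representative cocycle is principal on `I_F`. Element form of
`oneCocycleClass_mem_unramifiedSubgroup_iff_exists`. [cite: MilneADT2006, Ch. I §2 (unramified cohomology)] -/
theorem mem_unramifiedSubgroup_one_iff_exists_oneCocycleClass (x : galoisCohomology ρ 1) :
    x ∈ ρ.unramifiedSubgroup 1 ↔
      ∃ φ : contOneCocycles ρ.toTopRep, oneCocycleClass ρ.toTopRep φ = x ∧
        ∃ w : W, ∀ τ ∈ absInertia F, φ.1 τ = ρ τ w - w := by
  constructor
  · intro hx
    obtain ⟨φ, rfl⟩ := oneCocycleClass_surjective ρ.toTopRep x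
    exact ⟨φ, rfl, (ρ.oneCocycleClass_mem_unramifiedSubgroup_iff_exists φ).mp hx⟩
  · rintro ⟨φ, rfl, hφ⟩
    exact (ρ.oneCocycleClass_mem_unramifiedSubgroup_iff_exists φ).mpr hφ

end Unramified

end DiscreteGaloisModule

end Literature.NumberTheory.GaloisRepresentations
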